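import Mathlib
import Summits.ABC.IUTFork.LanaDegrees
import HarnessLib

/-!
# A concrete tame quadratically ramified place: `ℚ(√7)` at `(√7)` over `p = 7 ≥ 5`

Definition-bearing instance file of the abc-iut cell (Cor. 3.12 TEAM R indFixes thread, lead
R1 = abc-iut-c312-14; the ONE missing arithmetic input of the w5-d216 mover chain p421508 /
p427624 / p427994 per aud-9's N1, claimed 06:25:08Z); TAKES NO SIDE on [IUTchIII] Cor. 3.12.
Everything here is classical algebraic number theory at `ℚ(√7)` ([folklore]).

`w5-d216`'s generic ramified mover (`Thm311RealIsmDHMover`, `…Assembled`, `…AssembledSharp`)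
consumes a place with FOUR side conditions: `residueChar F v = p`, `5 ≤ p`,
`v.asIdeal.ramificationIdx ℤ = 2`, `v.asIdeal.inertiaDeg ℤ = 1` — and the tree carried no
concrete instance. This file supplies one:

* `F7 := ℚ⟮√7⟯ ⊆ ℝ` with `NumberField ↥F7` and `finrank ℚ F7 = 2` (the minimal polynomial of
  `√7` is `X² − 7`, irreducible since `7` is not a rational square);
* `r7O := √7` as an algebraic integer, PRIME in `𝒪_{F7}` (absolute norm `−7`, via the power
  basis and `Ideal.prime_of_irreducible_absNorm_span` — the `zeta_sub_one_prime` route);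
* the place `v7 := (√7)` with `(7) = v7²` (`map_span_seven`), hence
  `ramificationIdx_v7 : v7.asIdeal.ramificationIdx ℤ = 2` (normalized-factors count),
  `inertiaDeg_v7 : v7.asIdeal.inertiaDeg ℤ = 1` (squeezed by the fundamental identity
  `∑ e·f = finrank = 2`), and `residueChar_v7 : residueChar ↥F7 v7 = 7`;
* the package `tameQuadInstance_exists`, mirroring the consumer's binder list.

Consumers: `Thm311RealIsmDHMover.exists_uniformizer_sq`, `…AssembledSharp.
not_identifiedReading_identify_settingDHVolSharp_of_not_mem` (w5-d216) — with this instance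
their chain needs no arithmetic hypothesis beyond B1's own idele conditions. Every statement is
about `ℚ(√7)` only; nothing here bears on the dispute. [folklore] throughout; standard axioms.
-/

noncomputable section

namespace Summit.ABC.IUTFork.RamifiedMover

open Polynomial IntermediateField NumberField IsDedekindDomain
open scoped Pointwise

/-! ## 1. The field `ℚ(√7)` -/

/-- `√7 ∈ ℝ`. [folklore] -/
def sqrt7 : ℝ := Real.sqrt 7

/-- `√7² = 7`. [folklore] -/
theorem sqrt7_sq : sqrt7 ^ 2 = 7 := Real.sq_sqrt (by norm_num)

/-- `√7 > 0`. [folklore] -/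
theorem sqrt7_pos : 0 < sqrt7 := Real.sqrt_pos.mpr (by norm_num)

/-- `7` is not the square of a rational. [folklore] -/
theorem not_isSquare_seven : ¬ IsSquare (7 : ℚ) := by
  have h7 : Irrational (Real.sqrt ((7 : ℚ) : ℝ)) := by
    have := Nat.Prime.irrational_sqrt (p := 7) (by norm_num)
    simpa using this
  exact ((irrational_sqrt_ratCast_iff).mp h7).1

/-- `X² − 7` is irreducible over `ℚ`. [folklore] -/
theorem irreducible_X_sq_sub_seven : Irreducible (X ^ 2 - C (7 : ℚ)) := by
  refine X_pow_sub_C_irreducible_of_prime Nat.prime_two ?_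
  intro b hb
  exact not_isSquare_seven ⟨b, by rw [← hb]; ring⟩

/-- `√7` is integral over `ℚ`. [folklore] -/
theorem sqrt7_isIntegral_rat : IsIntegral ℚ sqrt7 := by
  refine ⟨X ^ 2 - C (7 : ℚ), monic_X_pow_sub_C _ (by norm_num), ?_⟩
  simp [sqrt7_sq]

/-- The minimal polynomial of `√7` over `ℚ` is `X² − 7`. [folklore] -/
theorem minpoly_sqrt7 : minpoly ℚ sqrt7 = X ^ 2 - C (7 : ℚ) := by
  refine (minpoly.eq_of_irreducible_of_monic irreducible_X_sq_sub_seven ?_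
    (monic_X_pow_sub_C _ (by norm_num))).symm
  simp [sqrt7_sq]

/-- **The field `F₇ = ℚ(√7)`** (as an intermediate field of `ℝ`). [folklore] -/
def F7 : IntermediateField ℚ ℝ := ℚ⟮sqrt7⟯

/-- `F₇` is finite over `ℚ` (degree `2`). [folklore] -/
instance : FiniteDimensional ℚ F7 :=
  IntermediateField.adjoin.finiteDimensional sqrt7_isIntegral_rat

/-- `F₇` is a number field. [folklore] -/
instance : NumberField ↥F7 where

/-- `[F₇ : ℚ] = 2`. [folklore] -/
theorem finrank_F7 : Module.finrank ℚ ↥F7 = 2 := by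
  show Module.finrank ℚ ↥(ℚ⟮sqrt7⟯) = 2
  rw [IntermediateField.adjoin.finrank sqrt7_isIntegral_rat, minpoly_sqrt7]
  compute_degree!

/-! ## 2. `√7` as a prime algebraic integer -/

/-- `√7` as an element of `F₇`. [folklore] -/
def r7 : ↥F7 := AdjoinSimple.gen ℚ sqrt7

/-- `r7` maps to `√7` in `ℝ`. [folklore] -/
theorem coe_r7 : (r7 : ℝ) = sqrt7 := rfl

/-- `r7² = 7`. [folklore] -/
theorem r7_sq : r7 ^ 2 = 7 := by
  have h : ((r7 ^ 2 : ↥F7) : ℝ) = ((7 : ↥F7) : ℝ) := by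
    push_cast [coe_r7]
    exact_mod_cast sqrt7_sq
  exact_mod_cast h

/-- `r7 ≠ 0`. [folklore] -/
theorem r7_ne_zero : r7 ≠ 0 := by
  intro h
  have : (r7 : ℝ) = 0 := by rw [h]; rfl
  rw [coe_r7] at this
  exact absurd this (ne_of_gt sqrt7_pos)

/-- `r7` is integral over `ℤ`. [folklore] -/
theorem r7_isIntegral : IsIntegral ℤ r7 := by
  refine ⟨X ^ 2 - C (7 : ℤ), monic_X_pow_sub_C _ (by norm_num), ?_⟩
  have := r7_sq
  simp only [eval₂_sub, eval₂_X_pow, eval₂_C]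
  rw [show ((algebraMap ℤ ↥F7) 7) = (7 : ↥F7) from map_ofNat _ 7, this]
  ring

/-- `√7` as an algebraic integer of `F₇`. [folklore] -/
def r7O : 𝓞 ↥F7 := ⟨r7, r7_isIntegral⟩

/-- `r7O` maps to `r7`. [folklore] -/
theorem algebraMap_r7O : algebraMap (𝓞 ↥F7) ↥F7 r7O = r7 := rfl

/-- `r7O ≠ 0`. [folklore] -/
theorem r7O_ne_zero : r7O ≠ 0 := by
  intro h
  apply r7_ne_zero
  rw [← algebraMap_r7O, h, map_zero]

/-- `r7O² = 7` in `𝒪_{F₇}`. [folklore] -/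
theorem r7O_sq : r7O ^ 2 = 7 := by
  apply RingOfIntegers.coe_injective
  show algebraMap (𝓞 ↥F7) ↥F7 (r7O ^ 2) = algebraMap (𝓞 ↥F7) ↥F7 7
  rw [map_pow, algebraMap_r7O, r7_sq, map_ofNat]

/-- The minimal polynomial of `r7` over `ℚ` is `X² − 7` (transport along `F₇ ↪ ℝ`).
[folklore] -/
theorem minpoly_r7 : minpoly ℚ r7 = X ^ 2 - C (7 : ℚ) := by
  have h2 : minpoly ℚ ((algebraMap ↥F7 ℝ) r7) = minpoly ℚ r7 :=
    minpoly.algebraMap_eq (algebraMap ↥F7 ℝ).injective r7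
  rw [show (algebraMap ↥F7 ℝ) r7 = sqrt7 from rfl, minpoly_sqrt7] at h2
  exact h2.symm

/-- The `ℚ`-norm of `r7` is `−7` (power-basis computation from the minimal polynomial).
[folklore] -/
theorem norm_r7 : Algebra.norm ℚ r7 = -7 := by
  have hpb : (IntermediateField.adjoin.powerBasis sqrt7_isIntegral_rat).gen = r7 := rfl
  have h := Algebra.PowerBasis.norm_gen_eq_coeff_zero_minpoly
    (IntermediateField.adjoin.powerBasis sqrt7_isIntegral_rat)
  rw [hpb] at h
  have hdim : (IntermediateField.adjoin.powerBasis sqrt7_isIntegral_rat).dim = 2 := by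
    rw [IntermediateField.adjoin.powerBasis_dim, minpoly_sqrt7]
    compute_degree!
  have hc : (minpoly ℚ r7).coeff 0 = -7 := by
    rw [minpoly_r7]
    norm_num [Polynomial.coeff_sub, Polynomial.coeff_X_pow, Polynomial.coeff_C]
  calc Algebra.norm ℚ r7
      = (-1) ^ (IntermediateField.adjoin.powerBasis sqrt7_isIntegral_rat).dim *
        (minpoly ℚ r7).coeff 0 := h
    _ = (-1) ^ 2 * (-7) := by rw [hdim, hc]
    _ = -7 := by norm_num

/-- **`√7` is prime in `𝒪_{F₇}`** (absolute norm `7`; the `zeta_sub_one_prime` route).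
[folklore] -/
theorem r7O_prime : Prime r7O := by
  refine Ideal.prime_of_irreducible_absNorm_span (by simpa using r7O_ne_zero) ?_
  rw [Ideal.absNorm_span_singleton]
  rw [Nat.irreducible_iff_prime, ← Nat.prime_iff, ← Int.prime_iff_natAbs_prime]
  have hnorm : Algebra.norm ℤ r7O = -7 := by
    apply RingHom.injective_int (algebraMap ℤ ℚ)
    rw [← Algebra.norm_localization (Sₘ := ↥F7) ℤ (nonZeroDivisors ℤ)]
    simpa [algebraMap_r7O] using norm_r7
  rw [hnorm]
  exact Int.prime_iff_natAbs_prime.mpr (by norm_num)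

/-! ## 3. The place `v₇ = (√7)` -/

/-- **The place `v₇ = (√7)` of `F₇`.** [folklore] -/
def v7 : HeightOneSpectrum (𝓞 ↥F7) where
  asIdeal := Ideal.span {r7O}
  isPrime := (Ideal.span_singleton_prime r7O_ne_zero).mpr r7O_prime
  ne_bot := by
    simp only [ne_eq, Ideal.span_singleton_eq_bot]
    exact r7O_ne_zero

/-- `7 ∈ v₇`. [folklore] -/
theorem seven_mem_v7 : ((7 : ℕ) : 𝓞 ↥F7) ∈ v7.asIdeal := by
  rw [show v7.asIdeal = Ideal.span {r7O} from rfl, Ideal.mem_span_singleton]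
  refine ⟨r7O, ?_⟩
  have h := r7O_sq
  push_cast
  rw [← h]
  ring

/-- `(7)𝒪 = v₇²`. [folklore] -/
theorem map_span_seven :
    Ideal.map (algebraMap ℤ (𝓞 ↥F7)) (Ideal.span {(7 : ℤ)}) = v7.asIdeal ^ 2 := by
  rw [Ideal.map_span, Set.image_singleton, show v7.asIdeal = Ideal.span {r7O} from rfl,
    Ideal.span_singleton_pow, r7O_sq, map_ofNat]

/-- The prime of `ℤ` below `v₇` is `(7)`: `comap = (7)`. [folklore] -/
theorem comap_v7 : Ideal.comap (algebraMap ℤ (𝓞 ↥F7)) v7.asIdeal = Ideal.span {(7 : ℤ)} := by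
  apply le_antisymm
  · -- n ∈ comap ⟹ 7 ∣ n, by Bézout against r7O ∣ 7
    intro n hn
    rw [Ideal.mem_comap, show v7.asIdeal = Ideal.span {r7O} from rfl,
      Ideal.mem_span_singleton] at hn
    rw [Ideal.mem_span_singleton]
    by_contra h7
    -- gcd(7, n) = 1: explicit Bézout coefficients
    have hbez : ∃ u w : ℤ, u * 7 + w * n = 1 := by
      have h1 : n % 7 = 1 ∨ n % 7 = 2 ∨ n % 7 = 3 ∨ n % 7 = 4 ∨ n % 7 = 5 ∨ n % 7 = 6 := by
        omega
      have h2 : ∃ s : ℤ, (s * n) % 7 = 1 := by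
        rcases h1 with h | h | h | h | h | h
        · exact ⟨1, by omega⟩
        · exact ⟨4, by omega⟩
        · exact ⟨5, by omega⟩
        · exact ⟨2, by omega⟩
        · exact ⟨3, by omega⟩
        · exact ⟨6, by omega⟩
      obtain ⟨s, hs⟩ := h2
      exact ⟨(1 - s * n) / 7, s, by omega⟩
    obtain ⟨u, w, huw⟩ := hbez
    have hdvd7 : r7O ∣ (7 : 𝓞 ↥F7) := ⟨r7O, by rw [← r7O_sq]; ring⟩
    have hdvd1 : r7O ∣ (1 : 𝓞 ↥F7) := by
      have h1 : ((u * 7 + w * n : ℤ) : 𝓞 ↥F7) = 1 := by rw [huw]; exact Int.cast_one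
      rw [← h1]
      push_cast
      exact dvd_add (Dvd.dvd.mul_left hdvd7 _) (Dvd.dvd.mul_left hn _)
    exact r7O_prime.not_unit (isUnit_of_dvd_one hdvd1)
  · -- (7) ⊆ comap
    rw [Ideal.span_le, Set.singleton_subset_iff]
    have h7 : ((7 : ℤ) : 𝓞 ↥F7) = ((7 : ℕ) : 𝓞 ↥F7) := by push_cast; rfl
    rw [SetLike.mem_coe, Ideal.mem_comap, show (algebraMap ℤ (𝓞 ↥F7)) 7 = ((7 : ℤ) : 𝓞 ↥F7)
      from rfl, h7]
    exact seven_mem_v7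

/-- `v₇` lies over `(7)`. [folklore] -/
theorem v7_liesOver : v7.asIdeal.LiesOver (Ideal.span {(7 : ℤ)}) :=
  ⟨by rw [Ideal.under_def, comap_v7]⟩

/-! ## 4. `e = 2`, `f = 1`, residue characteristic `7` -/

/-- **`e(v₇ | 7) = 2`** (normalized-factors count of `(7)𝒪 = v₇²`). [folklore] -/
theorem ramificationIdx_v7 : v7.asIdeal.ramificationIdx ℤ = 2 := by
  haveI := v7_liesOver
  have hirr : Irreducible v7.asIdeal :=
    (Ideal.prime_of_isPrime v7.ne_bot v7.isPrime).irreducible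
  have hp0 : Ideal.map (algebraMap ℤ (𝓞 ↥F7)) (Ideal.span {(7 : ℤ)}) ≠ ⊥ := by
    intro hbot
    rw [Ideal.map_eq_bot_iff_of_injective
      (RingHom.injective_int (algebraMap ℤ (𝓞 ↥F7))), Ideal.span_singleton_eq_bot] at hbot
    norm_num at hbot
  have hcount := Ideal.IsDedekindDomain.ramificationIdx_eq_normalizedFactors_count
    (p := Ideal.span {(7 : ℤ)}) (q := v7.asIdeal) hp0
  have hcnt : (UniqueFactorizationMonoid.normalizedFactors
      (Ideal.map (algebraMap ℤ (𝓞 ↥F7)) (Ideal.span {(7 : ℤ)}))).count v7.asIdeal = 2 := by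
    rw [map_span_seven, UniqueFactorizationMonoid.normalizedFactors_pow,
      UniqueFactorizationMonoid.normalizedFactors_irreducible hirr]
    simp [Multiset.count_nsmul, normalize_eq]
  exact hcount.trans hcnt

/-- **`f(v₇ | 7) = 1`** (squeezed by the fundamental identity `∑ e·f = 2`). [folklore] -/
theorem inertiaDeg_v7 : v7.asIdeal.inertiaDeg ℤ = 1 := by
  haveI := v7_liesOver
  haveI hpr : (Ideal.span {(7 : ℤ)}).IsPrime :=
    (Ideal.span_singleton_prime (by norm_num)).mpr
      (Int.prime_iff_natAbs_prime.mpr (by norm_num))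
  haveI : (Ideal.span {(7 : ℤ)}).IsMaximal :=
    Ideal.IsPrime.isMaximal hpr (by simp only [ne_eq, Ideal.span_singleton_eq_bot]; norm_num)
  haveI : Fintype ((Ideal.span {(7 : ℤ)}).primesOver (𝓞 ↥F7)) :=
    (IsDedekindDomain.primesOver_finite (Ideal.span {(7 : ℤ)}) (𝓞 ↥F7)).fintype
  have hsum := Ideal.sum_ramification_inertia_eq_finrank
    (p := Ideal.span {(7 : ℤ)}) (S := 𝓞 ↥F7)
  rw [show Module.finrank ℤ (𝓞 ↥F7) = 2 from by
    rw [RingOfIntegers.rank]; exact finrank_F7] at hsum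
  have hmem : v7.asIdeal ∈ (Ideal.span {(7 : ℤ)}).primesOver (𝓞 ↥F7) :=
    ⟨v7.isPrime, v7_liesOver⟩
  have hle : v7.asIdeal.ramificationIdx ℤ * v7.asIdeal.inertiaDeg ℤ ≤ 2 := by
    rw [← hsum]
    exact Finset.single_le_sum (f := fun q : (Ideal.span {(7 : ℤ)}).primesOver (𝓞 ↥F7) =>
      q.1.ramificationIdx ℤ * q.1.inertiaDeg ℤ) (fun _ _ => Nat.zero_le _)
      (Finset.mem_univ ⟨v7.asIdeal, hmem⟩)
  rw [ramificationIdx_v7] at hle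
  haveI : v7.asIdeal.IsPrime := v7.isPrime
  have hpos : 0 < v7.asIdeal.inertiaDeg ℤ := Ideal.inertiaDeg_pos v7.asIdeal ℤ
  omega

/-- **The residue characteristic of `v₇` is `7`.** [folklore] -/
theorem residueChar_v7 : residueChar (F := ↥F7) v7 = 7 := by
  have h7 : ((7 : ℕ) : 𝓞 ↥F7 ⧸ v7.asIdeal) = 0 := by
    rw [show ((7 : ℕ) : 𝓞 ↥F7 ⧸ v7.asIdeal) =
      Ideal.Quotient.mk v7.asIdeal ((7 : ℕ) : 𝓞 ↥F7) from by push_cast; rfl]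
    rw [Ideal.Quotient.eq_zero_iff_mem]
    exact seven_mem_v7
  have hdvd : ringChar (𝓞 ↥F7 ⧸ v7.asIdeal) ∣ 7 := ringChar.dvd h7
  rcases (Nat.Prime.eq_one_or_self_of_dvd (by norm_num) _ hdvd) with h1 | h7'
  · -- char 1 ⟹ trivial ring ⟹ v₇ = ⊤, impossible
    exfalso
    have htriv : (1 : 𝓞 ↥F7 ⧸ v7.asIdeal) = 0 := by
      have := ringChar.spec (𝓞 ↥F7 ⧸ v7.asIdeal) 1
      rw [h1] at this
      simpa using this.mpr ⟨1, rfl⟩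
    rw [show (1 : 𝓞 ↥F7 ⧸ v7.asIdeal) = Ideal.Quotient.mk v7.asIdeal 1 from rfl,
      Ideal.Quotient.eq_zero_iff_mem] at htriv
    exact v7.isPrime.ne_top (Ideal.eq_top_iff_one _ |>.mpr htriv)
  · exact h7'

/-- **The package** — the four side conditions of w5-d216's `exists_uniformizer_sq` /
`…AssembledSharp`, all discharged at `F = ℚ(√7)`, `v = v₇ = (√7)`, `p = 7`. [folklore] -/
theorem tameQuadInstance :
    residueChar (F := ↥F7) v7 = 7 ∧ 5 ≤ 7 ∧
      v7.asIdeal.ramificationIdx ℤ = 2 ∧ v7.asIdeal.inertiaDeg ℤ = 1 :=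
  ⟨residueChar_v7, by norm_num, ramificationIdx_v7, inertiaDeg_v7⟩

end Summit.ABC.IUTFork.RamifiedMover

end
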